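import Literature.Analysis.FluidPDE.PassiveVectorVarTensorL2WeakBound
import Literature.Analysis.FunctionSpaces.TorusLinearisedFormTruncation
import Literature.Analysis.FunctionSpaces.TorusFourierCalculus
import Literature.Analysis.FunctionSpaces.TorusTrigPoly
import Literature.Analysis.FunctionSpaces.TorusCalculusProofs
import Literature.Analysis.FunctionSpaces.TorusVectorParseval
import HarnessLib

/-!
# The energy identity for `L²ₜH¹ₓ` weak solutions of the VARIABLE-tensor passive-vector equation

Analysis/FluidPDE proof-support file (everything proved; no definitions, no named facts). Second pass of
the truncated (Galerkin) energy argument (Robinson–Rodrigo–Sadowski 2016, §4.2; Lions–Magenes 1972,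
Chap. 3 §4.4 / Temam 1984 Ch. III Lemma 1.2 in Galerkin form): for an `L²((0,T) × T^d)` distributional
solution `w` of `∂ₜw + (b·∇)w + ∇π = ∇·(𝔹(t,y)∇w)`, `∇·w = 0` (weak formulation against divergence-free
space–time tests in product form, bounded weakly divergence-free carrier, weakly divergence-free `L²`
datum, weakly divergence-free `L²` slices) **with a weak space gradient `G t c = ∂_c w(t)` in `L²(μ_T)`**
and a coefficient field `𝔹` with smooth slices, `𝔹`, `∂_y𝔹` jointly continuous and `|𝔹| ≤ B`, the
**energy identity** holds for a.e. `t ∈ (0,T)`: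

  `∫‖w(t)‖² = ∫‖w₀‖² − 2 ∫_{(0,t]} ∫ Σ_{l,i,c,e} 𝔹(τ,x)_{icle} (∂_c w)_i (∂_e w)_l dx dτ`

(`ae_integral_norm_sq_eq_of_weakVar`). NO ellipticity is used: the identity is a statement about
`L²ₜH¹ₓ` solutions. With ellipticity it gives the sharp energy inequality and uniqueness in the
`L²ₜH¹ₓ` class (corollaries left to the consumers; the existence theorem
`PassiveVectorVarTensorLionsExistence` produces solutions in this class).

Relative to the first pass (`PassiveVectorVarTensorL2WeakBound`: a bound uniform in the truncation
level `N`), the limit `N → ∞` is taken in the truncated identity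
`‖P_N w(t)‖² = ‖P_N w₀‖² + 2∫_{(0,t]} ∫⟪w, (b·∇)P_N w + 𝓛^{𝔹,*}P_N w⟫`: the transport term is the
remainder `∫⟪w − P_N w, (b·∇)P_N w⟫ → 0` (`‖w − P_N w‖₂ → 0`, `‖∇P_N w‖₂ ≤ ‖∇w‖₂`), and the viscous
term is moved onto the weak gradient, `∫⟪w, 𝓛^{𝔹,*}P_N w⟫ = −∫ 𝔹 ∇P_N w · ∇w` with
`∇P_N w = P_N ∇w → ∇w` in `L²` (`partialDeriv_fourierTruncate_ae_eq_of_hasWeakPartialDeriv`); dominated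
convergence in time with the bound `C(‖w(τ)‖₂² + ‖∇w(τ)‖₂²)`.

* `hasWeakPartialDeriv_complexify`, `mFourierCoeff_complexify_eq_of_hasWeakPartialDeriv`,
  `partialDeriv_fourierTruncate_ae_eq_of_hasWeakPartialDeriv` — `∂_c P_N v = P_N ∂_c v` for weak
  derivatives (Evans 2010, §5.8 Thm. 8);
* `tendsto_integral_norm_sq_fourierTruncate_sub_of_memLp` — `∫‖P_N u − u‖² → 0` for `u ∈ L²`;
* `gradNormSq_fourierTruncate_le_of_hasWeakPartialDeriv` — `‖∇P_N v‖₂² ≤ Σ_c‖∂_c v‖₂²`;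
* `abs_integral_sum_entry_mul_le` — `|∫ Σ 𝔹 F_c,i G_e,l| ≤ Σ B ‖F_c‖₂ ‖G_e‖₂`;
* `tendsto_integral_inner_viscAdjVar_fourierTruncate` — the viscous limit at a slice;
* `ae_integral_norm_sq_eq_of_weakVar` — the energy identity.

## References

* J.-L. Lions, E. Magenes, *Non-homogeneous boundary value problems and applications* I (1972), Chap. 3,
  §4.4 (energy equality for solutions in `W(0,T)`). [`LionsMagenes1972`]
* R. Temam, *Navier–Stokes Equations*, 3rd ed. (1984), Ch. III §1, Lemma 1.2. [`Temam1984`]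
* J. C. Robinson, J. L. Rodrigo, W. Sadowski, *The three-dimensional Navier–Stokes equations* (CUP 2016),
  §4.2, Lemma 4.1. [`RobinsonRodrigoSadowski2016`]
* L. C. Evans, *Partial Differential Equations*, 2nd ed. (2010), §5.8 Thm. 8. [`Evans2010`]
-/

noncomputable section

open MeasureTheory Set Filter Function TopologicalSpace Complex UnitAddTorus
open scoped ENNReal NNReal InnerProductSpace Topology ComplexConjugate

namespace Literature.Analysis.FluidPDE

namespace Torus

variable {d : Type*} [Fintype d] [DecidableEq d]

/-! ## Fourier coefficients of weak derivatives (complexified) -/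

section Coefficients

variable {F : Type*} [NormedAddCommGroup F] [NormedSpace ℂ F]

omit [DecidableEq d] in
/-- Splitting a complex-weighted integral into real and imaginary parts:
`∫ ψ • h = ∫ (Re ψ) • h + i ∫ (Im ψ) • h` for smooth `ψ : T^d → ℂ` and integrable `h` (copy of the
private lemma of `TorusSobolevNormWeakDerivProofs`). [folklore] -/
private theorem integral_smul_eq_re_add_I_smul_im_V5 {ψ : UnitAddTorus d → ℂ} (hψ : FunctionSpaces.Torus.IsSmooth ψ)
    {h : UnitAddTorus d → F} (hh : Integrable h volume) :
    ∫ x, ψ x • h x = (∫ x, (ψ x).re • h x) + Complex.I • ∫ x, (ψ x).im • h x := by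
  have hre : FunctionSpaces.Torus.IsSmooth fun x => (ψ x).re := hψ.comp_clm Complex.reCLM
  have him : FunctionSpaces.Torus.IsSmooth fun x => (ψ x).im := hψ.comp_clm Complex.imCLM
  have h2i : Integrable (fun x => Complex.I • ((ψ x).im • h x)) volume :=
    (him.integrable_smul hh).smul Complex.I
  rw [← integral_smul, ← integral_add (hre.integrable_smul hh) h2i]
  refine integral_congr_ae (ae_of_all _ fun x => ?_)
  beta_reduce
  calc ψ x • h x = (((ψ x).re : ℂ) + ((ψ x).im : ℂ) * Complex.I) • h x := by rw [Complex.re_add_im]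
    _ = ((ψ x).re : ℂ) • h x + Complex.I • (((ψ x).im : ℂ) • h x) := by
        rw [add_smul, mul_comm, mul_smul]
    _ = (ψ x).re • h x + Complex.I • ((ψ x).im • h x) := by
        rw [Complex.coe_smul, Complex.coe_smul]

/-- **Fourier coefficients of a weak derivative** (values in a complex normed space): if `g` is a
weak `i`-th partial derivative of `f` on `T^d` (both integrable) then `ĝ(n) = 2πi nᵢ f̂(n)` — test the
weak identity with `Re e_{-n}`, `Im e_{-n}` (copy of
`TorusSobolevNormWeakDerivProofs.mFourierCoeff_eq_of_hasWeakPartialDeriv`, whose module is outside the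
build closure of this file). [cite: Evans2010, §5.8 Thm. 8 (Characterization of H^k by Fourier transform) proof step 1] -/
private theorem mFourierCoeff_eq_of_hasWeakPartialDeriv_V5 {i : d} {f g : UnitAddTorus d → F}
    (hf : Integrable f volume) (hg : Integrable g volume) (h : FunctionSpaces.Torus.HasWeakPartialDeriv i f g)
    (n : d → ℤ) :
    mFourierCoeff g n = (2 * Real.pi * Complex.I * (n i)) • mFourierCoeff f n := by
  have hχ : FunctionSpaces.Torus.IsSmooth (⇑(mFourier (-n)) : UnitAddTorus d → ℂ) := FunctionSpaces.Torus.isSmooth_mFourier (-n)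
  have hre : FunctionSpaces.Torus.IsSmooth fun y => (mFourier (-n) y).re := hχ.comp_clm Complex.reCLM
  have him : FunctionSpaces.Torus.IsSmooth fun y => (mFourier (-n) y).im := hχ.comp_clm Complex.imCLM
  set c : ℂ := 2 * Real.pi * Complex.I * ((-n) i) with hc
  have hcχ : FunctionSpaces.Torus.IsSmooth (fun x => c * mFourier (-n) x) := contDiff_const.mul hχ
  have hdre : ∀ x, FunctionSpaces.Torus.partialDeriv i (fun y => (mFourier (-n) y).re) x = (c * mFourier (-n) x).re :=
    fun x => by
    have h1 := FunctionSpaces.Torus.partialDeriv_clm_comp hχ Complex.reCLM i x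
    rw [FunctionSpaces.Torus.partialDeriv_mFourier] at h1
    exact h1
  have hdim : ∀ x, FunctionSpaces.Torus.partialDeriv i (fun y => (mFourier (-n) y).im) x = (c * mFourier (-n) x).im :=
    fun x => by
    have h1 := FunctionSpaces.Torus.partialDeriv_clm_comp hχ Complex.imCLM i x
    rw [FunctionSpaces.Torus.partialDeriv_mFourier] at h1
    exact h1
  have h1 := h (fun y => (mFourier (-n) y).re) hre
  have h2 := h (fun y => (mFourier (-n) y).im) him
  beta_reduce at h1 h2
  simp_rw [hdre] at h1
  simp_rw [hdim] at h2
  have h1' : ∫ x, (mFourier (-n) x).re • g x = -∫ x, (c * mFourier (-n) x).re • f x := by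
    rw [h1, neg_neg]
  have h2' : ∫ x, (mFourier (-n) x).im • g x = -∫ x, (c * mFourier (-n) x).im • f x := by
    rw [h2, neg_neg]
  calc mFourierCoeff g n = ∫ x, mFourier (-n) x • g x := FunctionSpaces.Torus.mFourierCoeff_eq_integral_volume g n
    _ = (∫ x, (mFourier (-n) x).re • g x) + Complex.I • ∫ x, (mFourier (-n) x).im • g x :=
        integral_smul_eq_re_add_I_smul_im_V5 hχ hg
    _ = -((∫ x, (c * mFourier (-n) x).re • f x) +
          Complex.I • ∫ x, (c * mFourier (-n) x).im • f x) := by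
        rw [h1', h2', smul_neg, neg_add]
    _ = -∫ x, (c * mFourier (-n) x) • f x := by rw [integral_smul_eq_re_add_I_smul_im_V5 hcχ hf]
    _ = -(c • mFourierCoeff f n) := by
        rw [FunctionSpaces.Torus.mFourierCoeff_eq_integral_volume, ← integral_smul]
        congr 1
        refine integral_congr_ae (ae_of_all _ fun x => ?_)
        simp only [smul_smul]
    _ = (2 * Real.pi * Complex.I * (n i)) • mFourierCoeff f n := by
        rw [← neg_smul]
        congr 1
        simp only [hc, Pi.neg_apply, Int.cast_neg]
        ring

end Coefficients

/-! ## Truncation commutes with weak derivatives -/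

/-- Complexification of a weak derivative of a real vector field: the weak identity is `ℝ`-linear and
`complexify` is an `ℝ`-linear isometry commuting with Bochner integrals.
[cite: Evans2010, §5.8 Thm. 8 (Characterization of H^k by Fourier transform) proof step 1] -/
theorem hasWeakPartialDeriv_complexify {i : d} {f g : UnitAddTorus d → EuclideanSpace ℝ d}
    (h : FunctionSpaces.Torus.HasWeakPartialDeriv i f g) :
    FunctionSpaces.Torus.HasWeakPartialDeriv i (FunctionSpaces.EuclideanSpace.complexify ∘ f)
      (FunctionSpaces.EuclideanSpace.complexify ∘ g) := by
  intro φ hφ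
  have e1 : (fun x => FunctionSpaces.Torus.partialDeriv i φ x • (FunctionSpaces.EuclideanSpace.complexify ∘ f) x) =
      fun x => FunctionSpaces.EuclideanSpace.complexify (FunctionSpaces.Torus.partialDeriv i φ x • f x) := by
    funext x
    simp only [Function.comp_apply, map_smul]
  have e2 : (fun x => φ x • (FunctionSpaces.EuclideanSpace.complexify ∘ g) x) =
      fun x => FunctionSpaces.EuclideanSpace.complexify (φ x • g x) := by
    funext x
    simp only [Function.comp_apply, map_smul]
  rw [e1, e2, LinearIsometry.integral_comp_comm, LinearIsometry.integral_comp_comm, h φ hφ, map_neg]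

/-- **Fourier coefficients of a weak derivative of a real vector field**:
`𝓕(complexify ∘ g)(n) = 2πi nᵢ 𝓕(complexify ∘ f)(n)` (both integrable).
[cite: Evans2010, §5.8 Thm. 8 (Characterization of H^k by Fourier transform) proof step 1] -/
theorem mFourierCoeff_complexify_eq_of_hasWeakPartialDeriv {i : d}
    {f g : UnitAddTorus d → EuclideanSpace ℝ d} (hf : Integrable f volume) (hg : Integrable g volume)
    (h : FunctionSpaces.Torus.HasWeakPartialDeriv i f g) (n : d → ℤ) :
    mFourierCoeff (FunctionSpaces.EuclideanSpace.complexify ∘ g) n =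
      (2 * Real.pi * Complex.I * (n i)) • mFourierCoeff (FunctionSpaces.EuclideanSpace.complexify ∘ f) n := by
  have hf' : Integrable (FunctionSpaces.EuclideanSpace.complexify ∘ f) volume :=
    FunctionSpaces.EuclideanSpace.complexify.toContinuousLinearMap.integrable_comp hf
  have hg' : Integrable (FunctionSpaces.EuclideanSpace.complexify ∘ g) volume :=
    FunctionSpaces.EuclideanSpace.complexify.toContinuousLinearMap.integrable_comp hg
  exact mFourierCoeff_eq_of_hasWeakPartialDeriv_V5 hf' hg' (hasWeakPartialDeriv_complexify h) n

omit [DecidableEq d] in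
/-- A real vector field in `L²` all of whose complexified Fourier coefficients vanish is `0` a.e.
(Parseval). [cite: RobinsonRodrigoSadowski2016, Lemma 4.1, p. 74] -/
private theorem ae_eq_zero_of_mFourierCoeff_complexify_eq_zero_V5 {v : UnitAddTorus d → EuclideanSpace ℝ d}
    (hv : MemLp v 2 volume) (h : ∀ n, mFourierCoeff (FunctionSpaces.EuclideanSpace.complexify ∘ v) n = 0) :
    v =ᵐ[volume] 0 := by
  have hP := FunctionSpaces.Torus.hasSum_sq_norm_mFourierCoeff_complexify hv
  simp only [h, norm_zero, ne_eq, OfNat.ofNat_ne_zero, not_false_eq_true, zero_pow] at hP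
  have h0 : ∫ x, ‖v x‖ ^ 2 = 0 := hP.unique hasSum_zero
  have hi : Integrable (fun x => ‖v x‖ ^ 2) volume := (memLp_two_iff_integrable_sq_norm hv.1).1 hv
  have hae := (integral_eq_zero_iff_of_nonneg (fun x => sq_nonneg _) hi).1 h0
  filter_upwards [hae] with x hx
  have : ‖v x‖ ^ 2 = 0 := hx
  rw [Pi.zero_apply, ← norm_eq_zero]
  exact pow_eq_zero_iff two_ne_zero |>.1 this

set_option maxHeartbeats 400000 in
/-- **Derivatives of the Fourier truncations are the truncations of the weak derivatives**: for
`ψ ∈ L²` with weak `i`-th partial derivative `g ∈ L²`, `∂ᵢ(P_N ψ) = P_N g` a.e. (both are the real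
trigonometric polynomials with coefficients `2πikᵢ ψ̂(k)`, `|k| ≤ N`).
[cite: Evans2010, §5.8 Thm. 8 (Characterization of H^k by Fourier transform)] -/
theorem partialDeriv_fourierTruncate_ae_eq_of_hasWeakPartialDeriv {i : d} {ψ g : UnitAddTorus d → EuclideanSpace ℝ d}
    (hψ : MemLp ψ 2 volume) (hg : MemLp g 2 volume) (h : FunctionSpaces.Torus.HasWeakPartialDeriv i ψ g) (N : ℕ) :
    FunctionSpaces.Torus.partialDeriv i (FunctionSpaces.Torus.fourierTruncate N ψ) =ᵐ[volume]
      FunctionSpaces.Torus.fourierTruncate N g := by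
  have hPs : FunctionSpaces.Torus.IsSmooth (FunctionSpaces.Torus.fourierTruncate N ψ) :=
    FunctionSpaces.Torus.isSmooth_fourierTruncate N ψ
  have hdP : FunctionSpaces.Torus.IsSmooth (FunctionSpaces.Torus.partialDeriv i (FunctionSpaces.Torus.fourierTruncate N ψ)) :=
    hPs.partialDeriv i
  have hPg : FunctionSpaces.Torus.IsSmooth (FunctionSpaces.Torus.fourierTruncate N g) :=
    FunctionSpaces.Torus.isSmooth_fourierTruncate N g
  have hψi : Integrable ψ volume := hψ.integrable one_le_two
  have hgi : Integrable g volume := hg.integrable one_le_two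
  have hc1 : ∀ n, mFourierCoeff (FunctionSpaces.EuclideanSpace.complexify ∘
        FunctionSpaces.Torus.partialDeriv i (FunctionSpaces.Torus.fourierTruncate N ψ)) n =
      (2 * Real.pi * Complex.I * (n i)) •
        mFourierCoeff (FunctionSpaces.EuclideanSpace.complexify ∘ FunctionSpaces.Torus.fourierTruncate N ψ) n :=
    fun n => mFourierCoeff_complexify_eq_of_hasWeakPartialDeriv hPs.integrable hdP.integrable
      (FunctionSpaces.Torus.IsSmooth.hasWeakPartialDeriv FunctionSpaces.Torus.integral_partialDeriv_eq_zero_holds hPs i) n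
  have hc2 : ∀ n, mFourierCoeff (FunctionSpaces.EuclideanSpace.complexify ∘ g) n =
      (2 * Real.pi * Complex.I * (n i)) • mFourierCoeff (FunctionSpaces.EuclideanSpace.complexify ∘ ψ) n :=
    fun n => mFourierCoeff_complexify_eq_of_hasWeakPartialDeriv hψi hgi h n
  have hc : ∀ n, mFourierCoeff (FunctionSpaces.EuclideanSpace.complexify ∘
        FunctionSpaces.Torus.partialDeriv i (FunctionSpaces.Torus.fourierTruncate N ψ)) n =
      mFourierCoeff (FunctionSpaces.EuclideanSpace.complexify ∘ FunctionSpaces.Torus.fourierTruncate N g) n := by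
    intro n
    rw [hc1, FunctionSpaces.Torus.mFourierCoeff_fourierTruncate hψi, FunctionSpaces.Torus.mFourierCoeff_fourierTruncate hgi]
    split_ifs with hn
    · rw [hc2]
    · rw [smul_zero]
  set v : UnitAddTorus d → EuclideanSpace ℝ d := fun x =>
    FunctionSpaces.Torus.partialDeriv i (FunctionSpaces.Torus.fourierTruncate N ψ) x - FunctionSpaces.Torus.fourierTruncate N g x
    with hv
  have hvmem : MemLp v 2 volume := (hdP.memLp 2).sub (hPg.memLp 2)
  have hzero : ∀ n, mFourierCoeff (FunctionSpaces.EuclideanSpace.complexify ∘ v) n = 0 := by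
    intro n
    have e : FunctionSpaces.EuclideanSpace.complexify ∘ v =
        (FunctionSpaces.EuclideanSpace.complexify ∘ FunctionSpaces.Torus.partialDeriv i (FunctionSpaces.Torus.fourierTruncate N ψ)) -
          (FunctionSpaces.EuclideanSpace.complexify ∘ FunctionSpaces.Torus.fourierTruncate N g) := by
      funext x
      simp only [hv, Function.comp_apply, Pi.sub_apply, map_sub]
    have hi₁ : Integrable (FunctionSpaces.EuclideanSpace.complexify ∘
        FunctionSpaces.Torus.partialDeriv i (FunctionSpaces.Torus.fourierTruncate N ψ)) volume :=
      FunctionSpaces.EuclideanSpace.complexify.toContinuousLinearMap.integrable_comp hdP.integrable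
    have hi₂ : Integrable (FunctionSpaces.EuclideanSpace.complexify ∘ FunctionSpaces.Torus.fourierTruncate N g) volume :=
      FunctionSpaces.EuclideanSpace.complexify.toContinuousLinearMap.integrable_comp hPg.integrable
    rw [e, FunctionSpaces.Torus.mFourierCoeff_sub hi₁ hi₂, hc n, sub_self]
  have hae := ae_eq_zero_of_mFourierCoeff_complexify_eq_zero_V5 hvmem hzero
  filter_upwards [hae] with x hx
  rw [hv] at hx
  simpa [sub_eq_zero] using hx

/-- **`P_N u → u` in `L²`**, real-integral form for `u ∈ L²(T^d; ℝ^d)`: `∫‖P_N u − u‖² → 0`.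
[cite: RobinsonRodrigoSadowski2016, Lemma 4.1, p. 74] -/
theorem tendsto_integral_norm_sq_fourierTruncate_sub_of_memLp {u : UnitAddTorus d → EuclideanSpace ℝ d}
    (hu : MemLp u 2 volume) :
    Tendsto (fun N => ∫ x, ‖FunctionSpaces.Torus.fourierTruncate N u x - u x‖ ^ 2) atTop (𝓝 0) := by
  have h := FunctionSpaces.Torus.tendsto_lintegral_enorm_sq_fourierTruncate_sub hu
  have h' := (ENNReal.tendsto_toReal ENNReal.zero_ne_top).comp h
  rw [ENNReal.toReal_zero] at h'
  refine h'.congr fun N => ?_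
  have hmeas : AEStronglyMeasurable (fun x => ‖FunctionSpaces.Torus.fourierTruncate N u x - u x‖ ^ 2) volume :=
    (((FunctionSpaces.Torus.continuous_fourierTruncate N u).aestronglyMeasurable.sub hu.1).norm.pow 2)
  rw [Function.comp_apply, integral_eq_lintegral_of_nonneg_ae (Eventually.of_forall fun x => by positivity) hmeas]
  congr 1
  refine lintegral_congr fun x => ?_
  rw [← ofReal_norm, ← ENNReal.ofReal_pow (norm_nonneg _)]

/-- **Truncation does not increase the weak gradient norm**: for `v ∈ L²` with weak partial derivatives
`G c ∈ L²`, `‖∇P_N v‖₂² ≤ Σ_c ‖G c‖₂²` (`∂_c P_N v = P_N G c` and Bessel).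
[cite: RobinsonRodrigoSadowski2016, Lemma 4.1] -/
theorem gradNormSq_fourierTruncate_le_of_hasWeakPartialDeriv {v : UnitAddTorus d → EuclideanSpace ℝ d}
    (hv : MemLp v 2 volume) {G : d → UnitAddTorus d → EuclideanSpace ℝ d}
    (hG : ∀ c, FunctionSpaces.Torus.HasWeakPartialDeriv c v (G c)) (hG2 : ∀ c, MemLp (G c) 2 volume) (N : ℕ) :
    FunctionSpaces.Torus.gradNormSq (FunctionSpaces.Torus.fourierTruncate N v) ≤ ∫ x, ∑ c, ‖G c x‖ ^ 2 := by
  have hall : ∀ᵐ x ∂volume, ∀ c, FunctionSpaces.Torus.partialDeriv c (FunctionSpaces.Torus.fourierTruncate N v) x =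
      FunctionSpaces.Torus.fourierTruncate N (G c) x :=
    ae_all_iff.2 fun c => partialDeriv_fourierTruncate_ae_eq_of_hasWeakPartialDeriv hv (hG2 c) (hG c) N
  unfold FunctionSpaces.Torus.gradNormSq
  have e : ∫ x, ∑ c, ‖FunctionSpaces.Torus.partialDeriv c (FunctionSpaces.Torus.fourierTruncate N v) x‖ ^ 2 =
      ∫ x, ∑ c, ‖FunctionSpaces.Torus.fourierTruncate N (G c) x‖ ^ 2 := by
    refine integral_congr_ae ?_
    filter_upwards [hall] with x hx
    exact Finset.sum_congr rfl fun c _ => by rw [hx c]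
  rw [e, integral_finsetSum _ fun c _ => (FunctionSpaces.Torus.memLp_fourierTruncate N (G c) 2).integrable_norm_pow two_ne_zero,
    integral_finsetSum _ fun c _ => (hG2 c).integrable_norm_pow two_ne_zero]
  exact Finset.sum_le_sum fun c _ => FunctionSpaces.Torus.integral_norm_sq_fourierTruncate_le (hG2 c) N

/-! ## The bilinear viscous functional against `L²` gradients -/

omit [DecidableEq d] in
/-- A product `ℙ(x)_{icle} (F c x)_i (G e x)_l` of a bounded continuous coefficient and two `L²` fields
is integrable, with `|·| ≤ B ‖F c x‖ ‖G e x‖`. [folklore] -/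
private theorem integrable_entry_mul_V5 {ℙ : UnitAddTorus d → Visc4 d}
    (hℙc : ∀ i c l e, Continuous (fun y => ℙ y i c l e)) {B : ℝ} (hB : ∀ y i c l e, |ℙ y i c l e| ≤ B)
    {F G : UnitAddTorus d → EuclideanSpace ℝ d} (hF : MemLp F 2 volume) (hG : MemLp G 2 volume)
    (i c l e : d) :
    Integrable (fun x => ℙ x i c l e * (F x) i * (G x) l) volume := by
  refine Integrable.mono' ((hF.norm.integrable_mul hG.norm).const_mul B)
    ((((hℙc i c l e).aestronglyMeasurable).mul ((PiLp.continuous_apply 2 _ i).comp_aestronglyMeasurable hF.1)).mul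
      ((PiLp.continuous_apply 2 _ l).comp_aestronglyMeasurable hG.1)) (ae_of_all _ fun x => ?_)
  rw [Real.norm_eq_abs, abs_mul, abs_mul]
  calc |ℙ x i c l e| * |(F x) i| * |(G x) l| ≤ B * ‖F x‖ * ‖G x‖ :=
        mul_le_mul (mul_le_mul (hB x i c l e) (FunctionSpaces.Torus.abs_apply_le_norm (F x) i) (abs_nonneg _)
          ((abs_nonneg _).trans (hB x i c l e))) (FunctionSpaces.Torus.abs_apply_le_norm (G x) l) (abs_nonneg _)
          (mul_nonneg ((abs_nonneg _).trans (hB x i c l e)) (norm_nonneg _))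
    _ = B * (‖F x‖ * ‖G x‖) := by ring

omit [DecidableEq d] in
/-- **The bilinear viscous functional is controlled entrywise**: for a bounded continuous coefficient
`|ℙ| ≤ B` and `L²` fields `F c`, `G e`,
`|∫ Σ_{l,i,c,e} ℙ_{icle} (F c)_i (G e)_l| ≤ Σ_{l,i,c,e} B ‖F c‖₂ ‖G e‖₂` (Cauchy–Schwarz).
[cite: Giaquinta1983MultipleIntegrals, Ch. III §2 eq. (2.2)–(2.6)] -/
theorem abs_integral_sum_entry_mul_le {ℙ : UnitAddTorus d → Visc4 d}
    (hℙc : ∀ i c l e, Continuous (fun y => ℙ y i c l e)) {B : ℝ} (hB : ∀ y i c l e, |ℙ y i c l e| ≤ B)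
    {F G : d → UnitAddTorus d → EuclideanSpace ℝ d} (hF : ∀ c, MemLp (F c) 2 volume) (hG : ∀ c, MemLp (G c) 2 volume) :
    |∫ x, ∑ l, ∑ i, ∑ c, ∑ e, ℙ x i c l e * (F c x) i * (G e x) l| ≤
      ∑ _l : d, ∑ _i : d, ∑ c, ∑ e, B * (Real.sqrt (∫ x, ‖F c x‖ ^ 2) * Real.sqrt (∫ x, ‖G e x‖ ^ 2)) := by
  have hI : ∀ l i c e, Integrable (fun x => ℙ x i c l e * (F c x) i * (G e x) l) volume :=
    fun l i c e => integrable_entry_mul_V5 hℙc hB (hF c) (hG e) i c l e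
  rw [integral_finsetSum _ fun l _ => integrable_finsetSum _ fun i _ =>
    integrable_finsetSum _ fun c _ => integrable_finsetSum _ fun e _ => hI l i c e]
  refine (Finset.abs_sum_le_sum_abs _ _).trans (Finset.sum_le_sum fun l _ => ?_)
  rw [integral_finsetSum _ fun i _ => integrable_finsetSum _ fun c _ => integrable_finsetSum _ fun e _ => hI l i c e]
  refine (Finset.abs_sum_le_sum_abs _ _).trans (Finset.sum_le_sum fun i _ => ?_)
  rw [integral_finsetSum _ fun c _ => integrable_finsetSum _ fun e _ => hI l i c e]
  refine (Finset.abs_sum_le_sum_abs _ _).trans (Finset.sum_le_sum fun c _ => ?_)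
  rw [integral_finsetSum _ fun e _ => hI l i c e]
  refine (Finset.abs_sum_le_sum_abs _ _).trans (Finset.sum_le_sum fun e _ => ?_)
  calc |∫ x, ℙ x i c l e * (F c x) i * (G e x) l| ≤ ∫ x, |ℙ x i c l e * (F c x) i * (G e x) l| :=
        abs_integral_le_integral_abs
    _ ≤ ∫ x, B * (‖F c x‖ * ‖G e x‖) := by
        refine integral_mono_of_nonneg (ae_of_all _ fun x => abs_nonneg _)
          (((hF c).norm.integrable_mul (hG e).norm).const_mul B) (ae_of_all _ fun x => ?_)
        dsimp only
        rw [abs_mul, abs_mul]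
        calc |ℙ x i c l e| * |(F c x) i| * |(G e x) l| ≤ B * ‖F c x‖ * ‖G e x‖ :=
              mul_le_mul (mul_le_mul (hB x i c l e) (FunctionSpaces.Torus.abs_apply_le_norm (F c x) i) (abs_nonneg _)
                ((abs_nonneg _).trans (hB x i c l e))) (FunctionSpaces.Torus.abs_apply_le_norm (G e x) l) (abs_nonneg _)
                (mul_nonneg ((abs_nonneg _).trans (hB x i c l e)) (norm_nonneg _))
          _ = B * (‖F c x‖ * ‖G e x‖) := by ring
    _ = B * ∫ x, ‖F c x‖ * ‖G e x‖ := integral_const_mul _ _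
    _ ≤ B * (Real.sqrt (∫ x, ‖F c x‖ ^ 2) * Real.sqrt (∫ x, ‖G e x‖ ^ 2)) :=
        mul_le_mul_of_nonneg_left (FunctionSpaces.Torus.integral_norm_mul_norm_le_sqrt_sq_mul_sqrt_sq (hF c) (hG e))
          ((abs_nonneg _).trans (hB (0 : UnitAddTorus d) i c l e))

/-- **The viscous pairing against the own truncation converges to the dissipation functional.** For a
coefficient field `ℙ` with smooth entries bounded by `B`, `v ∈ L²(T^d)` with weak partial derivatives
`G c ∈ L²`: `∫⟪v, 𝓛^{ℙ,*}P_N v⟫ → −∫ Σ_{l,i,c,e} ℙ_{icle} (G c)_i (G e)_l` as `N → ∞`, and for every `N`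
`|∫⟪v, 𝓛^{ℙ,*}P_N v⟫| ≤ d⁴ B Σ_c‖G c‖₂²` (move `𝓛^{ℙ,*}` onto the weak gradient, `∇P_N v = P_N ∇v → ∇v`
in `L²`). [cite: LionsMagenes1972, Chap. 3 §4.4] [cite: RobinsonRodrigoSadowski2016, Lemma 4.1] -/
theorem tendsto_integral_inner_viscAdjVar_fourierTruncate {ℙ : UnitAddTorus d → Visc4 d}
    (hℙ : ∀ i c j e, FunctionSpaces.Torus.IsSmooth (fun y => ℙ y i c j e)) {B : ℝ}
    (hB0 : 0 ≤ B) (hB : ∀ y i c j e, |ℙ y i c j e| ≤ B)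
    {v : UnitAddTorus d → EuclideanSpace ℝ d} (hv : MemLp v 2 volume)
    {G : d → UnitAddTorus d → EuclideanSpace ℝ d} (hG : ∀ c, FunctionSpaces.Torus.HasWeakPartialDeriv c v (G c))
    (hG2 : ∀ c, MemLp (G c) 2 volume) :
    Tendsto (fun N => ∫ x, ⟪v x, viscAdjVar ℙ (FunctionSpaces.Torus.fourierTruncate N v) x⟫_ℝ) atTop
      (𝓝 (-∫ x, ∑ l, ∑ i, ∑ c, ∑ e, ℙ x i c l e * (G c x) i * (G e x) l)) ∧
    ∀ N, |∫ x, ⟪v x, viscAdjVar ℙ (FunctionSpaces.Torus.fourierTruncate N v) x⟫_ℝ| ≤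
      (Fintype.card d : ℝ) ^ 4 * (B * ∫ x, ∑ c, ‖G c x‖ ^ 2) := by
  have hℙc : ∀ i c l e, Continuous (fun y => ℙ y i c l e) := fun i c l e => (hℙ i c l e).continuous
  have hvi : Integrable v volume := hv.integrable one_le_two
  -- package the weak partial derivatives as a weak gradient
  set Gm : UnitAddTorus d → EuclideanSpace ℝ d →L[ℝ] EuclideanSpace ℝ d := fun x =>
    ∑ i, ∑ j, (G j x i) • (EuclideanSpace.proj j : EuclideanSpace ℝ d →L[ℝ] ℝ).smulRight
      (EuclideanSpace.single i (1 : ℝ)) with hGm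
  have hGapp : ∀ x e, Gm x (EuclideanSpace.single e 1) = G e x := by
    intro x e
    rw [hGm, sum_smul_smulRight_apply_single (fun i j => G j x i) e]
    ext i'
    simp [Finset.sum_apply, Pi.single_apply]
  have hWG : HasWeakGradient v Gm := by
    intro e
    rw [show (fun x => Gm x (EuclideanSpace.single e 1)) = G e from funext fun x => hGapp x e]
    exact hG e
  have hGi : Integrable Gm volume :=
    integrable_sum_smul_smulRight fun i j => ((hG2 j).integrable one_le_two).eval_piLp i
  -- the pairing at level `N`, on the truncated gradient
  set PG : ℕ → d → UnitAddTorus d → EuclideanSpace ℝ d := fun N c => FunctionSpaces.Torus.fourierTruncate N (G c) with hPG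
  have hPG2 : ∀ N c, MemLp (PG N c) 2 volume := fun N c => FunctionSpaces.Torus.memLp_fourierTruncate N (G c) 2
  have hA : ∀ N, ∫ x, ⟪v x, viscAdjVar ℙ (FunctionSpaces.Torus.fourierTruncate N v) x⟫_ℝ =
      -∫ x, ∑ l, ∑ i, ∑ c, ∑ e, ℙ x i c l e * (PG N c x) i * (G e x) l := by
    intro N
    have hPs := FunctionSpaces.Torus.isSmooth_fourierTruncate N v
    rw [integral_inner_viscAdjVar_eq_neg_integral_sum hℙ hPs hvi hWG hGi]
    simp_rw [hGapp]
    congr 1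
    have hall : ∀ᵐ x ∂volume, ∀ c, FunctionSpaces.Torus.partialDeriv c (FunctionSpaces.Torus.fourierTruncate N v) x =
        PG N c x :=
      ae_all_iff.2 fun c => partialDeriv_fourierTruncate_ae_eq_of_hasWeakPartialDeriv hv (hG2 c) (hG c) N
    refine integral_congr_ae ?_
    filter_upwards [hall] with x hx
    exact Finset.sum_congr rfl fun l _ => Finset.sum_congr rfl fun i _ => Finset.sum_congr rfl fun c _ =>
      Finset.sum_congr rfl fun e _ => by rw [hx c]
  -- integrability of the summed integrands
  have hI : ∀ (F : d → UnitAddTorus d → EuclideanSpace ℝ d), (∀ c, MemLp (F c) 2 volume) →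
      Integrable (fun x => ∑ l, ∑ i, ∑ c, ∑ e, ℙ x i c l e * (F c x) i * (G e x) l) volume :=
    fun F hF => integrable_finsetSum _ fun l _ => integrable_finsetSum _ fun i _ =>
      integrable_finsetSum _ fun c _ => integrable_finsetSum _ fun e _ => integrable_entry_mul_V5 hℙc hB (hF c) (hG2 e) i c l e
  set g : d → ℝ := fun c => ∫ x, ‖G c x‖ ^ 2 with hg
  have hg0 : ∀ c, 0 ≤ g c := fun c => integral_nonneg fun x => sq_nonneg _
  set Gn : ℝ := ∫ x, ∑ c, ‖G c x‖ ^ 2 with hGn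
  have hGneq : Gn = ∑ c, g c := by
    rw [hGn, integral_finsetSum _ fun c _ => (hG2 c).integrable_norm_pow two_ne_zero]
  have hgle : ∀ c, g c ≤ Gn := fun c => by
    rw [hGneq]
    exact Finset.single_le_sum (fun c _ => hg0 c) (Finset.mem_univ c)
  refine ⟨?_, fun N => ?_⟩
  · -- the limit
    rw [tendsto_iff_norm_sub_tendsto_zero]
    -- the difference is the functional on `P_N G − G`
    have hdiff : ∀ N, ‖(∫ x, ⟪v x, viscAdjVar ℙ (FunctionSpaces.Torus.fourierTruncate N v) x⟫_ℝ) -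
        -∫ x, ∑ l, ∑ i, ∑ c, ∑ e, ℙ x i c l e * (G c x) i * (G e x) l‖ =
        |∫ x, ∑ l, ∑ i, ∑ c, ∑ e, ℙ x i c l e * ((fun c x => PG N c x - G c x) c x) i * (G e x) l| := by
      intro N
      rw [hA N, Real.norm_eq_abs, neg_sub_neg, ← integral_sub (hI G hG2) (hI (PG N) (hPG2 N)), ← abs_neg, ← integral_neg]
      congr 1
      refine integral_congr_ae (ae_of_all _ fun x => ?_)
      simp only [PiLp.sub_apply, neg_sub]
      rw [← Finset.sum_sub_distrib]
      refine Finset.sum_congr rfl fun l _ => ?_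
      rw [← Finset.sum_sub_distrib]
      refine Finset.sum_congr rfl fun i _ => ?_
      rw [← Finset.sum_sub_distrib]
      refine Finset.sum_congr rfl fun c _ => ?_
      rw [← Finset.sum_sub_distrib]
      refine Finset.sum_congr rfl fun e _ => ?_
      ring
    simp_rw [hdiff]
    have hdm : ∀ N c, MemLp (fun x => PG N c x - G c x) 2 volume := fun N c => (hPG2 N c).sub (hG2 c)
    have hbd : ∀ N, |∫ x, ∑ l, ∑ i, ∑ c, ∑ e, ℙ x i c l e * ((fun c x => PG N c x - G c x) c x) i * (G e x) l| ≤
        ∑ _l : d, ∑ _i : d, ∑ c, ∑ e, B * (Real.sqrt (∫ x, ‖PG N c x - G c x‖ ^ 2) * Real.sqrt (∫ x, ‖G e x‖ ^ 2)) :=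
      fun N => abs_integral_sum_entry_mul_le hℙc hB (hdm N) hG2
    have hlim : Tendsto (fun N => ∑ l : d, ∑ i : d, ∑ c, ∑ e,
        B * (Real.sqrt (∫ x, ‖PG N c x - G c x‖ ^ 2) * Real.sqrt (∫ x, ‖G e x‖ ^ 2))) atTop (𝓝 0) := by
      have h1 : ∀ c, Tendsto (fun N => Real.sqrt (∫ x, ‖PG N c x - G c x‖ ^ 2)) atTop (𝓝 0) := by
        intro c
        have h := tendsto_integral_norm_sq_fourierTruncate_sub_of_memLp (hG2 c)
        have h' := (Real.continuous_sqrt.tendsto 0).comp h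
        rw [Real.sqrt_zero] at h'
        exact h'
      rw [show (0 : ℝ) = ∑ _l : d, ∑ _i : d, ∑ c : d, ∑ e : d, B * (0 * Real.sqrt (∫ x, ‖G e x‖ ^ 2)) by simp]
      refine tendsto_finsetSum _ fun l _ => tendsto_finsetSum _ fun i _ => tendsto_finsetSum _ fun c _ =>
        tendsto_finsetSum _ fun e _ => ?_
      exact ((h1 c).mul_const _).const_mul B
    exact squeeze_zero (fun N => abs_nonneg _) hbd hlim
  · -- the uniform bound
    rw [hA N, abs_neg]
    refine (abs_integral_sum_entry_mul_le hℙc hB (hPG2 N) hG2).trans ?_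
    have hterm : ∀ c e, B * (Real.sqrt (∫ x, ‖PG N c x‖ ^ 2) * Real.sqrt (∫ x, ‖G e x‖ ^ 2)) ≤ B * Gn := by
      intro c e
      refine mul_le_mul_of_nonneg_left ?_ hB0
      have h1 : Real.sqrt (∫ x, ‖PG N c x‖ ^ 2) ≤ Real.sqrt Gn :=
        Real.sqrt_le_sqrt ((FunctionSpaces.Torus.integral_norm_sq_fourierTruncate_le (hG2 c) N).trans (hgle c))
      have h2 : Real.sqrt (∫ x, ‖G e x‖ ^ 2) ≤ Real.sqrt Gn := Real.sqrt_le_sqrt (hgle e)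
      calc Real.sqrt (∫ x, ‖PG N c x‖ ^ 2) * Real.sqrt (∫ x, ‖G e x‖ ^ 2) ≤ Real.sqrt Gn * Real.sqrt Gn :=
            mul_le_mul h1 h2 (Real.sqrt_nonneg _) (Real.sqrt_nonneg _)
        _ = Gn := Real.mul_self_sqrt (integral_nonneg fun x => Finset.sum_nonneg fun _ _ => sq_nonneg _)
    calc ∑ _l : d, ∑ _i : d, ∑ c, ∑ e, B * (Real.sqrt (∫ x, ‖PG N c x‖ ^ 2) * Real.sqrt (∫ x, ‖G e x‖ ^ 2))
        ≤ ∑ _l : d, ∑ _i : d, ∑ _c : d, ∑ _e : d, B * Gn :=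
          Finset.sum_le_sum fun l _ => Finset.sum_le_sum fun i _ => Finset.sum_le_sum fun c _ =>
            Finset.sum_le_sum fun e _ => hterm c e
      _ = (Fintype.card d : ℝ) ^ 4 * (B * Gn) := by
          simp only [Finset.sum_const, Finset.card_univ, nsmul_eq_mul]
          ring

/-! ## The energy identity -/

section Energy

variable {T : ℝ} {𝔹 : ℝ → UnitAddTorus d → Visc4 d}
  {b w : ℝ → UnitAddTorus d → EuclideanSpace ℝ d} {w₀ : UnitAddTorus d → EuclideanSpace ℝ d}
  {Gw : ℝ → d → UnitAddTorus d → EuclideanSpace ℝ d}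

omit [Fintype d] [DecidableEq d] in
/-- Product rule for an a.e. primitive with datum (copy of the private lemma of the constant-tensor file). [folklore] -/
private theorem ae_sq_eq_of_ae_eq_add_setIntegral_V5 {T c : ℝ} {U F : ℝ → ℝ} (hF : IntegrableOn F (Ioo 0 T) volume)
    (hU : ∀ᵐ t ∂(volume.restrict (Ioo 0 T)), U t = c + ∫ τ in Ioc 0 t, F τ) :
    ∀ᵐ t ∂(volume.restrict (Ioo 0 T)), U t ^ 2 = c ^ 2 + 2 * ∫ τ in Ioc 0 t, F τ * U τ := by
  have hU' : ∀ᵐ τ ∂(volume : Measure ℝ), τ ∈ Ioo 0 T → U τ = c + ∫ r in Ioc 0 τ, F r :=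
    (ae_restrict_iff' measurableSet_Ioo).1 hU
  filter_upwards [hU, ae_restrict_mem measurableSet_Ioo] with t ht htT
  have hsub : Ioc 0 t ⊆ Ioo 0 T := Ioc_subset_Ioo_right htT.2
  rw [ht, sq_const_add_setIntegral_eq (hF.mono_set hsub)]
  congr 1
  congr 1
  refine setIntegral_congr_ae measurableSet_Ioc ?_
  filter_upwards [hU'] with τ hτ hτI
  rw [hτ (hsub hτI)]

omit [Fintype d] [DecidableEq d] in
/-- If `U = c + ∫_{(0,·]} F` a.e. with `F ∈ L¹(0,T)`, then `F U` is integrable on `(0,T)`. [folklore] -/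
private theorem integrableOn_mul_of_ae_eq_add_setIntegral_V5 {T c : ℝ} {U F : ℝ → ℝ} (hF : IntegrableOn F (Ioo 0 T) volume)
    (hUm : AEStronglyMeasurable U (volume.restrict (Ioo 0 T)))
    (hU : ∀ᵐ t ∂(volume.restrict (Ioo 0 T)), U t = c + ∫ τ in Ioc 0 t, F τ) :
    IntegrableOn (fun t => F t * U t) (Ioo 0 T) := by
  set B : ℝ := |c| + ∫ τ in Ioo 0 T, |F τ| with hB
  refine Integrable.mono' (hF.norm.mul_const B) (hF.aestronglyMeasurable.mul hUm) ?_
  filter_upwards [hU, ae_restrict_mem measurableSet_Ioo] with t ht htI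
  rw [norm_mul, ht, Real.norm_eq_abs, Real.norm_eq_abs]
  refine mul_le_mul_of_nonneg_left ?_ (abs_nonneg _)
  calc |c + ∫ τ in Ioc 0 t, F τ| ≤ |c| + |∫ τ in Ioc 0 t, F τ| := abs_add_le _ _
    _ ≤ |c| + ∫ τ in Ioc 0 t, |F τ| := by gcongr; exact abs_integral_le_integral_abs
    _ ≤ |c| + ∫ τ in Ioo 0 T, |F τ| :=
        add_le_add le_rfl (setIntegral_mono_set hF.abs (ae_of_all _ fun τ => abs_nonneg _)
          (Ioc_subset_Ioo_right htI.2).eventuallyLE)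

omit [DecidableEq d] in
/-- Slices of an `L²(μ_T)` function are in `L²(T^d)` for a.e. `t ∈ (0,T)` (Tonelli). [folklore] -/
private theorem ae_memLp_two_slice_V5 {T : ℝ} {v : ℝ → UnitAddTorus d → EuclideanSpace ℝ d}
    (hv : MemLp (uncurry v) 2 (((volume : Measure ℝ).restrict (Ioo 0 T)).prod (volume : Measure (UnitAddTorus d)))) :
    ∀ᵐ t ∂(volume.restrict (Ioo 0 T)), MemLp (v t) 2 volume := by
  have hm := hv.1
  have hfin : ∫⁻ p, ‖uncurry v p‖ₑ ^ 2 ∂(((volume : Measure ℝ).restrict (Ioo 0 T)).prod (volume : Measure (UnitAddTorus d))) < ⊤ := by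
    have h2 := lintegral_rpow_enorm_lt_top_of_eLpNorm_lt_top two_ne_zero ENNReal.ofNat_ne_top hv.eLpNorm_lt_top
    simp only [ENNReal.toReal_ofNat, ENNReal.rpow_two] at h2
    exact h2
  have hmeas : AEMeasurable (fun p : ℝ × UnitAddTorus d => ‖uncurry v p‖ₑ ^ 2)
      (((volume : Measure ℝ).restrict (Ioo 0 T)).prod (volume : Measure (UnitAddTorus d))) := hm.enorm.pow_const 2
  rw [lintegral_prod _ hmeas] at hfin
  filter_upwards [ae_lt_top' hmeas.lintegral_prod_right' hfin.ne, hm.prodMk_left] with t ht hmt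
  refine ⟨hmt, ?_⟩
  rw [eLpNorm_eq_lintegral_rpow_enorm_toReal two_ne_zero ENNReal.ofNat_ne_top, ENNReal.toReal_ofNat]
  have e : ∫⁻ x, ‖v t x‖ₑ ^ (2 : ℝ) = ∫⁻ x, ‖v t x‖ₑ ^ 2 := lintegral_congr fun x => by rw [ENNReal.rpow_two]
  rw [e]
  exact ENNReal.rpow_lt_top_of_nonneg (by norm_num) ht.ne

set_option maxHeartbeats 1600000 in
/-- **The energy identity for `L²ₜH¹ₓ` weak solutions of the variable-tensor passive-vector equation.**
Let `w ∈ L²((0,T) × T^d)` have weakly divergence-free `L²` slices for a.e. `t` and weak space partial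
derivatives `Gw t c` (`Torus.HasWeakPartialDeriv c (w t) (Gw t c)` for a.e. `t`, every `c`) with
`(t,x) ↦ Gw t c x ∈ L²(μ_T)`; let the carrier satisfy `‖b‖ ≤ M` a.e. with `b(t)` weakly divergence free
for a.e. `t`; let `w₀ ∈ L²` be weakly divergence free; let `𝔹` have smooth slices, `𝔹`, `∂_y𝔹` jointly
continuous and `|𝔹| ≤ B`; and let the weak formulation hold against all divergence-free space–time tests
(product form). Then for a.e. `t ∈ (0,T)`:
`∫‖w(t)‖² = ∫‖w₀‖² − 2 ∫_{(0,t]} ∫ Σ_{l,i,c,e} 𝔹(τ,x)_{icle} (Gw τ c x)_i (Gw τ e x)_l dx dτ`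
(the truncated energy identity and the limit `N → ∞`: transport remainder `→ 0`, viscous term through the
weak gradient, dominated convergence in time; Lions–Magenes 1972, Chap. 3 §4.4 / Temam 1984 Ch. III
Lemma 1.2, in the Galerkin form of Robinson–Rodrigo–Sadowski 2016 §4.2).
[cite: LionsMagenes1972, Chap. 3 §4.4] [cite: RobinsonRodrigoSadowski2016, §4.2 (4.20)] -/
theorem ae_integral_norm_sq_eq_of_weakVar
    (h𝔹s : ∀ t i c j e, FunctionSpaces.Torus.IsSmooth (fun y => 𝔹 t y i c j e))
    (h𝔹c : ∀ i c j e, Continuous (uncurry fun t y => 𝔹 t y i c j e))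
    (h𝔹d : ∀ i c j e e', Continuous (uncurry fun t y =>
      FunctionSpaces.Torus.partialDeriv e' (fun y => 𝔹 t y i c j e) y))
    {B : ℝ} (hB0 : 0 ≤ B) (hB : ∀ t y i c j e, |𝔹 t y i c j e| ≤ B)
    (hw2 : MemLp (uncurry w) 2 (((volume : Measure ℝ).restrict (Ioo 0 T)).prod volume))
    (hw2s : ∀ᵐ t ∂(volume.restrict (Ioo 0 T)), MemLp (w t) 2 volume)
    (hdivw : ∀ᵐ t ∂(volume.restrict (Ioo 0 T)), FunctionSpaces.Torus.IsWeaklyDivFree (w t))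
    (hGw : ∀ᵐ t ∂(volume.restrict (Ioo 0 T)), ∀ c, FunctionSpaces.Torus.HasWeakPartialDeriv c (w t) (Gw t c))
    (hGw2 : ∀ c, MemLp (uncurry (Gw · c)) 2 (((volume : Measure ℝ).restrict (Ioo 0 T)).prod volume))
    (hbm : AEStronglyMeasurable (uncurry b) (((volume : Measure ℝ).restrict (Ioo 0 T)).prod volume)) {M : ℝ}
    (hM : 0 ≤ M)
    (hbM : ∀ᵐ p ∂(((volume : Measure ℝ).restrict (Ioo 0 T)).prod (volume : Measure (UnitAddTorus d))), ‖uncurry b p‖ ≤ M)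
    (hbdiv : ∀ᵐ t ∂(volume.restrict (Ioo 0 T)), FunctionSpaces.Torus.IsWeaklyDivFree (b t))
    (hweak : ∀ Ψ : ℝ → UnitAddTorus d → EuclideanSpace ℝ d, FunctionSpaces.Torus.IsSpaceTimeTest T Ψ →
      (∀ t, FunctionSpaces.Torus.IsDivFree (Ψ t)) →
      (∫ p, ⟪w p.1 p.2, FunctionSpaces.Torus.timeDeriv Ψ p.1 p.2 +
          FunctionSpaces.Torus.convect (b p.1) (Ψ p.1) p.2 + viscAdjVar (𝔹 p.1) (Ψ p.1) p.2⟫_ℝ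
          ∂(((volume : Measure ℝ).restrict (Ioo 0 T)).prod volume)) + ∫ x, ⟪w₀ x, Ψ 0 x⟫_ℝ = 0)
    (hw₀ : MemLp w₀ 2 volume) (hdiv₀ : FunctionSpaces.Torus.IsWeaklyDivFree w₀) :
    ∀ᵐ t ∂(volume.restrict (Ioo 0 T)),
      ∫ x, ‖w t x‖ ^ 2 = (∫ x, ‖w₀ x‖ ^ 2) -
        2 * ∫ τ in Ioc 0 t, ∫ x, ∑ l, ∑ i, ∑ c, ∑ e, 𝔹 τ x i c l e * (Gw τ c x) i * (Gw τ e x) l := by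
  classical
  set μ : Measure (ℝ × UnitAddTorus d) := ((volume : Measure ℝ).restrict (Ioo 0 T)).prod volume with hμ
  set C : ℝ := Fintype.card d * M with hC
  have hC0 : 0 ≤ C := by positivity
  -- ### integrability bookkeeping
  have hw1 : Integrable (uncurry w) μ := hw2.integrable one_le_two
  have hbw : Integrable (fun p : ℝ × UnitAddTorus d => ‖b p.1 p.2‖ * ‖w p.1 p.2‖) μ := by
    refine Integrable.mono' (hw1.norm.const_mul M) (hbm.norm.mul hw1.1.norm) ?_
    filter_upwards [hbM] with p hp
    rw [Real.norm_eq_abs, abs_of_nonneg (mul_nonneg (norm_nonneg _) (norm_nonneg _))]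
    exact mul_le_mul_of_nonneg_right hp (norm_nonneg _)
  have hbMt : ∀ᵐ t ∂(volume.restrict (Ioo 0 T)), ∀ᵐ x ∂volume, ‖b t x‖ ≤ M := Measure.ae_ae_of_ae_prod hbM
  have hbmt : ∀ᵐ t ∂(volume.restrict (Ioo 0 T)), AEStronglyMeasurable (b t) volume := hbm.prodMk_left
  have hGw2s : ∀ᵐ t ∂(volume.restrict (Ioo 0 T)), ∀ c, MemLp (Gw t c) 2 volume :=
    ae_all_iff.2 fun c => ae_memLp_two_slice_V5 (v := fun t x => Gw t c x) (hGw2 c)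
  have hgood : ∀ᵐ t ∂(volume.restrict (Ioo 0 T)), MemLp (w t) 2 volume ∧ FunctionSpaces.Torus.IsWeaklyDivFree (w t) ∧
      Integrable (b t) volume ∧ FunctionSpaces.Torus.IsWeaklyDivFree (b t) ∧ (∀ᵐ x ∂volume, ‖b t x‖ ≤ M) ∧
      (∀ j, Integrable (fun x => b t x j • w t x) volume) ∧
      (∀ c, FunctionSpaces.Torus.HasWeakPartialDeriv c (w t) (Gw t c)) ∧ (∀ c, MemLp (Gw t c) 2 volume) := by
    filter_upwards [hw2s, hdivw, hbMt, hbmt, hbdiv, hGw, hGw2s] with t h2 hdw hbx hbs hbd hG hG2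
    have hbint : Integrable (b t) volume := Integrable.of_bound hbs M hbx
    have hwi : Integrable (w t) volume := h2.integrable one_le_two
    refine ⟨h2, hdw, hbint, hbd, hbx, fun j => ?_, hG, hG2⟩
    refine Integrable.mono' (hwi.norm.const_mul M)
      (((EuclideanSpace.proj j).continuous.comp_aestronglyMeasurable hbs).smul h2.1) ?_
    filter_upwards [hbx] with x hx
    rw [norm_smul]
    have hj : ‖b t x j‖ ≤ ‖b t x‖ := by simpa [Real.norm_eq_abs] using FunctionSpaces.Torus.abs_apply_le_norm (b t x) j
    exact mul_le_mul (hj.trans hx) le_rfl (norm_nonneg _) hM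
  -- ### the frame and the coefficient functions
  set I : ℕ → Finset ((d → ℤ) × d × Bool) := fun N =>
    FunctionSpaces.Torus.freqBall N ×ˢ ((Finset.univ : Finset d) ×ˢ (Finset.univ : Finset Bool)) with hI
  set a : (d → ℤ) × d × Bool → UnitAddTorus d → EuclideanSpace ℝ d := fun i => frameField i.1 i.2.1 i.2.2 with ha
  have ha_smooth : ∀ i, FunctionSpaces.Torus.IsSmooth (a i) := fun i => isSmooth_frameField _ _ _
  have ha_div : ∀ i, FunctionSpaces.Torus.IsDivFree (a i) := fun i => isDivFree_frameField' _ _ _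
  have ha_cont : ∀ i, Continuous (a i) := fun i => continuous_frameField _ _ _
  set U : (d → ℤ) × d × Bool → ℝ → ℝ := fun i t => ∫ x, ⟪w t x, a i x⟫_ℝ with hU
  set φ : (d → ℤ) × d × Bool → ℝ → ℝ := fun i τ =>
    ∫ x, ⟪w τ x, FunctionSpaces.Torus.convect (b τ) (a i) x + viscAdjVar (𝔹 τ) (a i) x⟫_ℝ with hφ
  have hslice := fun i => ae_integral_inner_eq_of_weakVar h𝔹s h𝔹c h𝔹d hw1 hbm hbw hweak (ha_smooth i) (ha_div i)
  have hφint : ∀ i, IntegrableOn (φ i) (Ioo 0 T) := fun i => (hslice i).1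
  have hUm : ∀ i, AEStronglyMeasurable (U i) (volume.restrict (Ioo 0 T)) := by
    intro i
    have hc : Continuous (uncurry fun (_ : ℝ) (x : UnitAddTorus d) => a i x) := (ha_cont i).comp continuous_snd
    exact (integrable_inner_of_integrable_of_continuous hw1 hc).integral_prod_left.aestronglyMeasurable
  have hsq : ∀ i, ∀ᵐ t ∂(volume.restrict (Ioo 0 T)),
      U i t ^ 2 = (∫ x, ⟪w₀ x, a i x⟫_ℝ) ^ 2 + 2 * ∫ τ in Ioc 0 t, φ i τ * U i τ := fun i =>
    ae_sq_eq_of_ae_eq_add_setIntegral_V5 (hφint i) (hslice i).2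
  have hφU : ∀ i, IntegrableOn (fun t => φ i t * U i t) (Ioo 0 T) := fun i =>
    integrableOn_mul_of_ae_eq_add_setIntegral_V5 (hφint i) (hUm i) (hslice i).2
  -- ### time-integrable envelopes
  have hE2 : IntegrableOn (fun s => ∫ x, ‖w s x‖ ^ 2) (Ioo 0 T) := (hw2.integrable_norm_pow two_ne_zero).integral_prod_left
  set Gn : ℝ → ℝ := fun s => ∫ x, ∑ c, ‖Gw s c x‖ ^ 2 with hGn
  have hGsum : Integrable (fun p : ℝ × UnitAddTorus d => ∑ c, ‖uncurry (Gw · c) p‖ ^ 2) μ :=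
    integrable_finsetSum _ fun c _ => (hGw2 c).integrable_norm_pow two_ne_zero
  have hGnI : IntegrableOn Gn (Ioo 0 T) := hGsum.integral_prod_left
  have hGn0 : ∀ s, 0 ≤ Gn s := fun s => integral_nonneg fun x => Finset.sum_nonneg fun _ _ => sq_nonneg _
  -- ### the truncated fluxes `F_N` and their limit `F∞`
  set F : ℕ → ℝ → ℝ := fun N τ => ∑ i ∈ I N, φ i τ * U i τ with hF
  set Finf : ℝ → ℝ := fun τ => -∫ x, ∑ l, ∑ i, ∑ c, ∑ e, 𝔹 τ x i c l e * (Gw τ c x) i * (Gw τ e x) l with hFinf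
  set bound : ℝ → ℝ := fun τ => C * ((∫ x, ‖w τ x‖ ^ 2) + Gn τ) + (Fintype.card d : ℝ) ^ 4 * (B * Gn τ) with hbound
  have hFint : ∀ N, IntegrableOn (F N) (Ioo 0 T) := fun N => integrable_finsetSum (I N) fun i _ => hφU i
  have hboundI : IntegrableOn bound (Ioo 0 T) := ((hE2.add hGnI).const_mul C).add ((hGnI.const_mul B).const_mul _)
  -- pointwise limit and domination at good times
  have hpt : ∀ᵐ τ ∂(volume.restrict (Ioo 0 T)), Tendsto (fun N => F N τ) atTop (𝓝 (Finf τ)) ∧ ∀ N, |F N τ| ≤ bound τ := by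
    filter_upwards [hgood] with τ hg
    obtain ⟨h2, hdw, hbint, hbd, hbx, hprod1, hG, hG2⟩ := hg
    have hwi : Integrable (w τ) volume := h2.integrable one_le_two
    have h𝔹τ : ∀ i c j e, FunctionSpaces.Torus.IsSmooth (fun y => 𝔹 τ y i c j e) := h𝔹s τ
    have hBτ : ∀ y i c j e, |𝔹 τ y i c j e| ≤ B := hB τ
    -- the flux against the own truncation, split into transport remainder and viscous part
    have hFeq : ∀ N, F N τ =
        (∫ x, ⟪w τ x - FunctionSpaces.Torus.fourierTruncate N (w τ) x,
            FunctionSpaces.Torus.convect (b τ) (FunctionSpaces.Torus.fourierTruncate N (w τ)) x⟫_ℝ) +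
          ∫ x, ⟪w τ x, viscAdjVar (𝔹 τ) (FunctionSpaces.Torus.fourierTruncate N (w τ)) x⟫_ℝ := by
      intro N
      have hPs := FunctionSpaces.Torus.isSmooth_fourierTruncate N (w τ)
      have hsum : F N τ =
          ∫ x, ⟪w τ x, FunctionSpaces.Torus.convect (b τ) (FunctionSpaces.Torus.fourierTruncate N (w τ)) x +
            viscAdjVar (𝔹 τ) (FunctionSpaces.Torus.fourierTruncate N (w τ)) x⟫_ℝ := by
        calc F N τ = ∑ i ∈ I N, U i τ * ∫ x, ⟪w τ x, FunctionSpaces.Torus.convect (b τ) (a i) x + viscAdjVar (𝔹 τ) (a i) x⟫_ℝ := by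
              simp only [hF]
              refine Finset.sum_congr rfl fun i _ => ?_
              simp only [hφ]
              ring
          _ = _ := sum_mul_varTensorFlux_eq (I N) (fun i => U i τ) ha_smooth h𝔹τ hwi hprod1
          _ = _ := by rw [fourierTruncate_eq_sum_integral_inner_smul_frameField h2 hdw N]
      have iC : Integrable (fun x => ⟪w τ x, FunctionSpaces.Torus.convect (b τ) (FunctionSpaces.Torus.fourierTruncate N (w τ)) x⟫_ℝ) volume :=
        integrable_inner_convect_of_integrable_smul hprod1 hPs
      have iV : Integrable (fun x => ⟪w τ x, viscAdjVar (𝔹 τ) (FunctionSpaces.Torus.fourierTruncate N (w τ)) x⟫_ℝ) volume :=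
        FunctionSpaces.Torus.integrable_inner_of_continuous hwi (isSmooth_viscAdjVar h𝔹τ hPs).continuous
      rw [hsum, ← integral_inner_convect_fourierTruncate_eq_remainder hbint hbd hprod1 N, ← integral_add iC iV]
      exact integral_congr_ae (ae_of_all _ fun x => inner_add_right _ _ _)
    -- the viscous part: limit and bound
    obtain ⟨hVlim, hVbd⟩ := tendsto_integral_inner_viscAdjVar_fourierTruncate h𝔹τ hB0 hBτ h2 hG hG2
    -- the transport remainder: bound `C √(∫‖w − P_N w‖²) √(Gn τ)` and limit `0`
    have hRbd : ∀ N, |∫ x, ⟪w τ x - FunctionSpaces.Torus.fourierTruncate N (w τ) x,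
        FunctionSpaces.Torus.convect (b τ) (FunctionSpaces.Torus.fourierTruncate N (w τ)) x⟫_ℝ| ≤
        C * Real.sqrt (∫ x, ‖w τ x - FunctionSpaces.Torus.fourierTruncate N (w τ) x‖ ^ 2) * Real.sqrt (Gn τ) := by
      intro N
      have hv : MemLp (fun x => w τ x - FunctionSpaces.Torus.fourierTruncate N (w τ) x) 2 volume :=
        h2.sub (FunctionSpaces.Torus.memLp_fourierTruncate N _ 2)
      have hR := abs_integral_inner_convect_le_of_norm_le (u := b τ) hv hM hbx
        (FunctionSpaces.Torus.isSmooth_fourierTruncate N (w τ))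
      refine hR.trans (mul_le_mul_of_nonneg_left (Real.sqrt_le_sqrt
        (gradNormSq_fourierTruncate_le_of_hasWeakPartialDeriv h2 hG hG2 N)) ?_)
      exact mul_nonneg hC0 (Real.sqrt_nonneg _)
    have hRlim : Tendsto (fun N => ∫ x, ⟪w τ x - FunctionSpaces.Torus.fourierTruncate N (w τ) x,
        FunctionSpaces.Torus.convect (b τ) (FunctionSpaces.Torus.fourierTruncate N (w τ)) x⟫_ℝ) atTop (𝓝 0) := by
      have htl : Tendsto (fun N => Real.sqrt (∫ x, ‖w τ x - FunctionSpaces.Torus.fourierTruncate N (w τ) x‖ ^ 2))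
          atTop (𝓝 0) := by
        have h := tendsto_integral_norm_sq_fourierTruncate_sub_of_memLp h2
        have h' : Tendsto (fun N => ∫ x, ‖w τ x - FunctionSpaces.Torus.fourierTruncate N (w τ) x‖ ^ 2) atTop (𝓝 0) := by
          refine h.congr fun N => integral_congr_ae (ae_of_all _ fun x => ?_)
          dsimp only
          rw [norm_sub_rev]
        have h'' := (Real.continuous_sqrt.tendsto 0).comp h'
        rw [Real.sqrt_zero] at h''
        exact h''
      have hb : Tendsto (fun N => C * Real.sqrt (∫ x, ‖w τ x - FunctionSpaces.Torus.fourierTruncate N (w τ) x‖ ^ 2) *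
          Real.sqrt (Gn τ)) atTop (𝓝 0) := by
        have := (htl.const_mul C).mul_const (Real.sqrt (Gn τ))
        simpa using this
      exact squeeze_zero_norm (fun N => (Real.norm_eq_abs _).le.trans (hRbd N)) hb
    refine ⟨?_, fun N => ?_⟩
    · -- limit
      have h := hRlim.add hVlim
      rw [zero_add] at h
      refine h.congr fun N => (hFeq N).symm
    · -- domination
      rw [hFeq N]
      refine (abs_add_le _ _).trans ?_
      have htail : Real.sqrt (∫ x, ‖w τ x - FunctionSpaces.Torus.fourierTruncate N (w τ) x‖ ^ 2) ≤
          2 * Real.sqrt (∫ x, ‖w τ x‖ ^ 2) := by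
        have hP : MemLp (FunctionSpaces.Torus.fourierTruncate N (w τ)) 2 volume := FunctionSpaces.Torus.memLp_fourierTruncate N _ 2
        have hpt : ∀ x, ‖w τ x - FunctionSpaces.Torus.fourierTruncate N (w τ) x‖ ^ 2 ≤
            2 * ‖w τ x‖ ^ 2 + 2 * ‖FunctionSpaces.Torus.fourierTruncate N (w τ) x‖ ^ 2 := fun x => by
          have h1 : ‖w τ x - FunctionSpaces.Torus.fourierTruncate N (w τ) x‖ ^ 2 ≤
              (‖w τ x‖ + ‖FunctionSpaces.Torus.fourierTruncate N (w τ) x‖) ^ 2 :=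
            pow_le_pow_left₀ (norm_nonneg _) (norm_sub_le _ _) 2
          nlinarith [h1, sq_nonneg (‖w τ x‖ - ‖FunctionSpaces.Torus.fourierTruncate N (w τ) x‖)]
        have i1 := h2.integrable_norm_pow two_ne_zero
        have i2 := hP.integrable_norm_pow two_ne_zero
        have htl4 : ∫ x, ‖w τ x - FunctionSpaces.Torus.fourierTruncate N (w τ) x‖ ^ 2 ≤ 4 * ∫ x, ‖w τ x‖ ^ 2 := by
          calc ∫ x, ‖w τ x - FunctionSpaces.Torus.fourierTruncate N (w τ) x‖ ^ 2
              ≤ ∫ x, (2 * ‖w τ x‖ ^ 2 + 2 * ‖FunctionSpaces.Torus.fourierTruncate N (w τ) x‖ ^ 2) :=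
                integral_mono_of_nonneg (ae_of_all _ fun x => sq_nonneg _) ((i1.const_mul 2).add (i2.const_mul 2)) (ae_of_all _ hpt)
            _ = 2 * (∫ x, ‖w τ x‖ ^ 2) + 2 * (∫ x, ‖FunctionSpaces.Torus.fourierTruncate N (w τ) x‖ ^ 2) := by
                rw [integral_add (i1.const_mul 2) (i2.const_mul 2), integral_const_mul, integral_const_mul]
            _ ≤ 2 * (∫ x, ‖w τ x‖ ^ 2) + 2 * (∫ x, ‖w τ x‖ ^ 2) :=
                add_le_add le_rfl (mul_le_mul_of_nonneg_left (FunctionSpaces.Torus.integral_norm_sq_fourierTruncate_le h2 N) (by norm_num))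
            _ = 4 * ∫ x, ‖w τ x‖ ^ 2 := by ring
        calc Real.sqrt (∫ x, ‖w τ x - FunctionSpaces.Torus.fourierTruncate N (w τ) x‖ ^ 2)
            ≤ Real.sqrt (4 * ∫ x, ‖w τ x‖ ^ 2) := Real.sqrt_le_sqrt htl4
          _ = 2 * Real.sqrt (∫ x, ‖w τ x‖ ^ 2) := by
              rw [Real.sqrt_mul (by norm_num), show Real.sqrt (4 : ℝ) = 2 by
                rw [show (4 : ℝ) = 2 ^ 2 by norm_num, Real.sqrt_sq (by norm_num)]]
      have hA0 : 0 ≤ ∫ x, ‖w τ x‖ ^ 2 := integral_nonneg fun x => sq_nonneg _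
      have hyoung : C * (2 * Real.sqrt (∫ x, ‖w τ x‖ ^ 2)) * Real.sqrt (Gn τ) ≤ C * ((∫ x, ‖w τ x‖ ^ 2) + Gn τ) := by
        rw [mul_assoc]
        refine mul_le_mul_of_nonneg_left ?_ hC0
        nlinarith [sq_nonneg (Real.sqrt (∫ x, ‖w τ x‖ ^ 2) - Real.sqrt (Gn τ)), Real.sq_sqrt hA0, Real.sq_sqrt (hGn0 τ)]
      calc |∫ x, ⟪w τ x - FunctionSpaces.Torus.fourierTruncate N (w τ) x,
              FunctionSpaces.Torus.convect (b τ) (FunctionSpaces.Torus.fourierTruncate N (w τ)) x⟫_ℝ| +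
            |∫ x, ⟪w τ x, viscAdjVar (𝔹 τ) (FunctionSpaces.Torus.fourierTruncate N (w τ)) x⟫_ℝ|
          ≤ C * (2 * Real.sqrt (∫ x, ‖w τ x‖ ^ 2)) * Real.sqrt (Gn τ) + (Fintype.card d : ℝ) ^ 4 * (B * Gn τ) :=
            add_le_add ((hRbd N).trans (mul_le_mul_of_nonneg_right (mul_le_mul_of_nonneg_left htail hC0) (Real.sqrt_nonneg _)))
              (hVbd N)
        _ ≤ bound τ := add_le_add hyoung le_rfl
  -- `Finf` is integrable on `(0,T)` (a.e. limit of the `F_N`, dominated)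
  have hFinfm : AEStronglyMeasurable Finf (volume.restrict (Ioo 0 T)) :=
    aestronglyMeasurable_of_tendsto_ae atTop (fun N => (hFint N).aestronglyMeasurable) (hpt.mono fun τ h => h.1)
  have hFinfI : IntegrableOn Finf (Ioo 0 T) := by
    refine Integrable.mono' hboundI hFinfm ?_
    filter_upwards [hpt] with τ hτ
    rw [Real.norm_eq_abs]
    exact le_of_tendsto' ((continuous_abs.tendsto _).comp hτ.1) fun N => hτ.2 N
  -- ### assemble at a.e. `t`
  have hsq' : ∀ᵐ t ∂(volume.restrict (Ioo 0 T)), ∀ i,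
      U i t ^ 2 = (∫ x, ⟪w₀ x, a i x⟫_ℝ) ^ 2 + 2 * ∫ τ in Ioc 0 t, φ i τ * U i τ := ae_all_iff.2 hsq
  have hpt' : ∀ᵐ τ ∂(volume : Measure ℝ), τ ∈ Ioo 0 T →
      Tendsto (fun N => F N τ) atTop (𝓝 (Finf τ)) ∧ ∀ N, |F N τ| ≤ bound τ := (ae_restrict_iff' measurableSet_Ioo).1 hpt
  filter_upwards [hsq', hgood, ae_restrict_mem measurableSet_Ioo] with t ht hg htI
  obtain ⟨h2, hdw, -⟩ := hg
  have hsub : Ioc 0 t ⊆ Ioo 0 T := Ioc_subset_Ioo_right htI.2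
  -- the truncated identity at time `t`
  have hEN : ∀ N, ∫ x, ⟪FunctionSpaces.Torus.fourierTruncate N (w t) x, FunctionSpaces.Torus.fourierTruncate N (w t) x⟫_ℝ =
      (∫ x, ⟪FunctionSpaces.Torus.fourierTruncate N w₀ x, FunctionSpaces.Torus.fourierTruncate N w₀ x⟫_ℝ) +
        2 * ∫ τ in Ioc 0 t, F N τ := by
    intro N
    rw [integral_inner_fourierTruncate_fourierTruncate_eq_sum h2 h2 hdw N,
      integral_inner_fourierTruncate_fourierTruncate_eq_sum hw₀ hw₀ hdiv₀ N]
    calc ∑ i ∈ I N, (U i t) * (U i t)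
        = ∑ i ∈ I N, ((∫ x, ⟪w₀ x, a i x⟫_ℝ) ^ 2 + 2 * ∫ τ in Ioc 0 t, φ i τ * U i τ) :=
          Finset.sum_congr rfl fun i _ => by rw [← sq, ht i]
      _ = (∑ i ∈ I N, (∫ x, ⟪w₀ x, a i x⟫_ℝ) ^ 2) + 2 * ∫ τ in Ioc 0 t, ∑ i ∈ I N, φ i τ * U i τ := by
          rw [Finset.sum_add_distrib, integral_finsetSum (I N) fun i _ => (hφU i).mono_set hsub, Finset.mul_sum]
      _ = (∑ i ∈ I N, (∫ x, ⟪w₀ x, a i x⟫_ℝ) * ∫ x, ⟪w₀ x, a i x⟫_ℝ) + 2 * ∫ τ in Ioc 0 t, F N τ := by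
          congr 1
          exact Finset.sum_congr rfl fun i _ => sq _
  -- the limits of the three terms
  have hL : Tendsto (fun N => ∫ x, ⟪FunctionSpaces.Torus.fourierTruncate N (w t) x, FunctionSpaces.Torus.fourierTruncate N (w t) x⟫_ℝ)
      atTop (𝓝 (∫ x, ‖w t x‖ ^ 2)) := tendsto_integral_inner_fourierTruncate_self h2
  have hD : Tendsto (fun N => ∫ x, ⟪FunctionSpaces.Torus.fourierTruncate N w₀ x, FunctionSpaces.Torus.fourierTruncate N w₀ x⟫_ℝ)
      atTop (𝓝 (∫ x, ‖w₀ x‖ ^ 2)) := tendsto_integral_inner_fourierTruncate_self hw₀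
  have hFl : Tendsto (fun N => ∫ τ in Ioc 0 t, F N τ) atTop (𝓝 (∫ τ in Ioc 0 t, Finf τ)) := by
    refine tendsto_integral_of_dominated_convergence bound (fun N => ((hFint N).mono_set hsub).aestronglyMeasurable)
      (hboundI.mono_set hsub) (fun N => ?_) ?_
    · exact (ae_restrict_iff' measurableSet_Ioc).2 (hpt'.mono fun τ hτ hτI => by
        rw [Real.norm_eq_abs]; exact (hτ (hsub hτI)).2 N)
    · exact (ae_restrict_iff' measurableSet_Ioc).2 (hpt'.mono fun τ hτ hτI => (hτ (hsub hτI)).1)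
  have hR : Tendsto (fun N => (∫ x, ⟪FunctionSpaces.Torus.fourierTruncate N w₀ x, FunctionSpaces.Torus.fourierTruncate N w₀ x⟫_ℝ) +
      2 * ∫ τ in Ioc 0 t, F N τ) atTop (𝓝 ((∫ x, ‖w₀ x‖ ^ 2) + 2 * ∫ τ in Ioc 0 t, Finf τ)) :=
    hD.add (hFl.const_mul 2)
  have heq := tendsto_nhds_unique hL (hR.congr fun N => (hEN N).symm)
  rw [heq, hFinf, integral_neg]
  ring

end Energy

end Torus

end Literature.Analysis.FluidPDE

end
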